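import Literature.Analysis.FluidPDE.HardSphereCollisionRecord
import Literature.Analysis.FluidPDE.DicedHardSphereDynamics
import Literature.Analysis.FluidPDE.HardSphereFlowConstruction
import Literature.MathematicalPhysics.KineticTheory.StochasticCollisionHardSphereProcess
import HarnessLib

/-!
# The kick-matched hard-sphere gas `Z*` and the chronological one-kick (Lindeberg) swap

Topic `Literature/MathematicalPhysics/KineticTheory` (definition item `defn-KickMatchedHardSphereGas`, wanted by
crux `stmt-AtomisticToContinuum-13914`, `InformationPercolationEngine.PercolationClosesChaos`). Tree home for the
vocabulary of the crux line `stein-lindeberg-kick-swap`: explicit functionals and an explicit noise-driven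
hard-sphere dynamics on the flat torus `𝕋³` at fixed reduced density `σ` (`N + 1` spheres of diameter
`ε = hsDiameter σ N`), built only from the library's hard-sphere prelude (`HardSphereFlow`, `collisionTimes(Of)`,
`nthCollisionTime`, `contactPairs`, `collidePair`, `reflectVel`, `empiricalMeasure`, `hardSphereDomain`,
`Torus.geometry/euclidDist/coarseCell`, `HardSphereFlow.nthRecordOf/coarsePastOf/nthPartnerOf`, `Driven.flow`,
`KernelGas.dice`, `Lambert.lift`). The BODIES are copied byte-for-byte from the line's skeleton
(`Summits/AtomisticToContinuum/HydrodynamicLimit/Cruxes/PercolationClosesChaos/Lines/stein-lindeberg-kick-swap.lean`)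
so that its registered stubs can be stated from `Theorems/` files over importable vocabulary; everything lives in
the grouping namespace `Literature.MathematicalPhysics.KineticTheory.KickMatchedHardSphereGas` (open it).

1. `defect σ N τ χ Ψ r γ` — the cross-ratio chaos defect `D = K_N[χ·Ψ·A_r] − K_N[χ·B^Ψ_r]` of the route target
   `ContactChaos` (stmt-AtomisticToContinuum-13477), its `let`-chain verbatim but as a functional of an arbitrary
   right-continuous path `γ : ℝ → Cfg N`, read on the deterministic orbit (`trueDefect`; `ContactChaos ↔ …` is then
   `Iff.rfl`), on the comparison gas (`starDefect`) and on the hybrids of the swap.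
2. `kickFunctional σ N Φ τ r g h z` (+ `PastWeight`, `IsFluxMeanZero`, `velWeight`) — the normalised weighted
   collision sum of crux `KickIsotropyInfo` (stmt-AtomisticToContinuum-13478), its `let`-chain verbatim
   (`KickIsotropyInfo ↔ …` by `Iff.rfl`); `velWeight s` = weights depending on the two pre-collisional velocities only.
3. The kick-matched gas `Z*`: `kickAt` (re-place the partner `j` at `x_i − εω`, then `collidePair`),
   `IsAdmissible`, `kmNormal` (rejection sampling of the flux law on admissible normals from a sequence of uniform
   unit-disc points lifted by `Lambert.lift`), `kmRule`, `kmFlow := Driven.flow geo ε kmRule`, `discLaw`, `Die`,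
   `kmDice := KernelGas.dice (KernelGas.dice discLaw)`, `starDefect`; and the time-`t` map on (datum, dice)
   `KickMatchedHardSphereGas σ N t (z, u) := kmFlow σ N u z t`.
4. The swap vocabulary: `collTime`, `numColl`, `postAt`, `pairAt`, `preAt`, `trueKick`, `contPath` (true past, `Z*`
   future), `phiEta`, `swapValue`, `influence`, `fluxLaw`, `restrictedMean`, `swapIntegrand`, `swapSum`, with the
   proved `stein_lindeberg_identity`, `outgoing_momentum_eq`, `outgoing_energy_eq`, `measurable_velWeight`,
   `abs_velWeight_le`, and the elementary API `phiEta_nonneg/le_one`, `abs_swapValue_le_one`.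

## References (design sources; every declaration here is a construction, tagged `[folklore]`)

* F. Comets, S. Popov, G. M. Schütz, M. Vachkovskaia, *Billiards in a general domain with random reflections*,
  ARMA 191 (2008), §2.2 (billiard driven by i.i.d. reflection draws; the cosine law `γ_d e·u`) and Thm 2.4
  (`μ₀ ⊗ ν₀` invariant for the Knudsen stochastic billiard). [CometsEtAl2008] — `kmNormal` draws the normal from the
  cosine (flux) law by lifting a uniform disc point (`Lambert.lift`), restricted by rejection.
* C. Cercignani, R. Illner, M. Pulvirenti, *The Mathematical Theory of Dilute Gases* (1994), App. 4.A (the collision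
  recursion; here with the reflection replaced by a noise-driven rule, `Driven.flow`). [CIP1994]
* F. Rezakhanlou, *A stochastic model associated with Enskog equation and its kinetic limit*, CMP 232 (2003)
  (stochastic hard-sphere collision mechanisms at contact). [Rezakhanlou2003]
* S. Chatterjee, *A generalization of the Lindeberg principle*, Ann. Probab. 34 (2006) (swap one input at a time;
  `stein_lindeberg_identity` is the chronological telescoping behind it). [Chatterjee2006]

## Not here

The line's four stubs (W: `Z*` measurable and Gibbs-stationary; S1: contact chaos for `Z*`; S2: one-kick influence;
S3: kick–ambient domination), their composition and the `Iff.rfl` bridges to the route decls are problem-side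
(`Summits/AtomisticToContinuum/HydrodynamicLimit/…`); no measurability, stationarity or limit statement is made
here — pure definitions plus elementary lemmas.
-/

noncomputable section

open scoped BigOperators ENNReal Topology RealInnerProductSpace
open MeasureTheory Set Filter
open Literature.Analysis.FluidPDE

namespace Literature.MathematicalPhysics.KineticTheory

namespace KickMatchedHardSphereGas

/-! ## Frame -/

/-- Phase space of `N + 1` hard spheres on `𝕋³`. [folklore] -/
abbrev Cfg (N : ℕ) : Type := Config (N + 1) (Fin 3) T3

/-- Hard-sphere flows on `𝕋³` at reduced diameter `σ` (diameter `hsDiameter σ N`). [folklore] -/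
abbrev Flow (σ : ℝ) (N : ℕ) : Type := HardSphereFlow (Torus.geometry (Fin 3)) (hsDiameter σ N) (N + 1)

/-- The torus geometry of `𝕋³` (minimal-image separation vectors). [folklore] -/
abbrev geo : Geometry (Fin 3) T3 := Torus.geometry (Fin 3)

/-! ## The cross-ratio chaos defect as a functional of a PATH -/

/-- **The cross-ratio chaos defect** `D = K_N[χ·Ψ·A_r] − K_N[χ·B^Ψ_r]` of the route target `ContactChaos`
(stmt-AtomisticToContinuum-13477), VERBATIM its `let`-chain but written as a functional of an arbitrary
(right-continuous, post-collisional) path `γ : ℝ → Cfg N` instead of the orbit `s ↦ (Φ N).flow s z`: `K_N[F]` is the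
`ε/(N+1)`-weighted sum over the collision times `s ∈ [0, τ]` of `γ` and the ordered contact pairs `(i, j)`
(`‖sepVec xᵢ xⱼ‖ = ε`) of the mark `F`; `A_r`, `B^Ψ_r` are the `r`-mollified (cone kernel `bx` in space, tent `bt` in
time) empirical pair fields `∫∫ Θ_1 μ⊗μ`, `∫∫ Θ_Ψ μ⊗μ`, `Θ_Ψ(v, w) = ∫ Ψ(ω, v, w) ((w−v)·ω)₊ dω`. The finsum takes the
junk value `0` when infinitely many collision times lie in `[0, τ]`. [folklore] -/
def defect (σ : ℝ) (N : ℕ) (τ : ℝ) (χ : ℝ × T3 → ℝ) (Ψ : V3 × V3 × V3 → ℝ) (r : ℝ) (γ : ℝ → Cfg N) : ℝ :=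
  let ε := hsDiameter σ N
  let G : Geometry (Fin 3) T3 := Torus.geometry (Fin 3)
  let bx : T3 → T3 → ℝ := fun x y => 3 / (Real.pi * r ^ 3) * max (1 - Torus.euclidDist x y / r) 0
  let bt : ℝ → ℝ := fun a => r⁻¹ * max (1 - |a| / r) 0
  let Θ := fun (Ξ : V3 × V3 × V3 → ℝ) (v w : V3) => ∫ ω : Metric.sphere (0 : V3) 1, Ξ ((ω : V3), v, w) * hardSphereKernel (w, v) ω ∂sphereMeasure
  let Pm : (V3 → V3 → ℝ) → ℝ → T3 → ℝ := fun Th s₀ x₀ => ∫ s in Set.Icc (0 : ℝ) τ, bt (s - s₀) * ∫ p, bx p.1.1 x₀ * bx p.2.1 x₀ * Th p.1.2 p.2.2 ∂((empiricalMeasure (γ s)).prod (empiricalMeasure (γ s)))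
  let Kc : (ℝ → Fin (N + 1) → Fin (N + 1) → ℝ) → ℝ := fun F => ε / (N + 1 : ℝ) * ∑ᶠ (s : ℝ) (_ : s ∈ collisionTimes G ε γ ∩ Set.Icc 0 τ), ∑ i : Fin (N + 1), ∑ j : Fin (N + 1), (if i ≠ j ∧ ‖G.sepVec (γ s i).1 (γ s j).1‖ = ε then F s i j else 0)
  let pv : ℝ → Fin (N + 1) → Fin (N + 1) → V3 × V3 := fun s i j => reflectVel (G.sepVec (γ s i).1 (γ s j).1) ((γ s i).2, (γ s j).2)
  Kc (fun s i j => χ (s, (γ s i).1) * Ψ (ε⁻¹ • G.sepVec (γ s i).1 (γ s j).1, (pv s i j).1, (pv s i j).2) * Pm (Θ (fun _ => 1)) s (γ s i).1) - Kc (fun s i _ => χ (s, (γ s i).1) * Pm (Θ Ψ) s (γ s i).1)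

/-- The defect of the DETERMINISTIC gas: `defect` on the orbit of `z` under `Φ`. [folklore] -/
abbrev trueDefect (σ : ℝ) (N : ℕ) (Φ : Flow σ N) (τ : ℝ) (χ : ℝ × T3 → ℝ) (Ψ : V3 × V3 × V3 → ℝ) (r : ℝ)
    (z : Cfg N) : ℝ :=
  defect σ N τ χ Ψ r fun s => Φ.flow s z

/-! ## The normalised weighted collision sum of `KickIsotropyInfo` -/

/-- The type of coarse-past weights of `KickIsotropyInfo`: `h i n (coarse past, partner label)` for the `n`-th
collision of sphere `i` (two coarse snapshots — `r`-cells and exact velocities of all spheres at the starts of the two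
flights ending in that collision — and the partner's label). [folklore] -/
abbrev PastWeight (N : ℕ) : Type :=
  Fin (N + 1) → ℕ → ((Fin (N + 1) → (Fin 3 → ℤ) × V3) × (Fin (N + 1) → (Fin 3 → ℤ) × V3)) × Fin (N + 1) → ℝ

/-- A kick test `g(ω, v, w)` has zero flux mean on the incoming hemisphere: `∫ g(ω,v,w) ((w−v)·ω)₊ dω = 0` for all
`v, w` (the side condition of `KickIsotropyInfo`, verbatim). [folklore] -/
def IsFluxMeanZero (g : V3 × V3 × V3 → ℝ) : Prop :=
  ∀ v w : V3, ∫ ω : Metric.sphere (0 : V3) 1, g ((ω : V3), v, w) * hardSphereKernel (w, v) ω ∂sphereMeasure = 0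

/-- **The normalised weighted collision sum of `KickIsotropyInfo`** (stmt-AtomisticToContinuum-13478), VERBATIM its
`let`-chain: `(ε/(N+1)) Σ_i Σ_{n < #collisions of i in (0,τ]} h_{i,n}(coarse past, partner) · g(ω_{i,n}, v⁻, v*⁻)`.
[folklore] -/
def kickFunctional (σ : ℝ) (N : ℕ) (Φ : Flow σ N) (τ r : ℝ) (g : V3 × V3 × V3 → ℝ) (h : PastWeight N)
    (z : Cfg N) : ℝ :=
  let ε := hsDiameter σ N
  let G : Geometry (Fin 3) T3 := Torus.geometry (Fin 3)
  let q : T3 → (Fin 3 → ℤ) := Torus.coarseCell r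
  let cnt : Cfg N → Fin (N + 1) → ℕ := fun z i => Set.ncard (collisionTimesOf G ε (fun t => Φ.flow t z) i ∩ Set.Ioc 0 τ)
  let c := fun (z : Cfg N) (i : Fin (N + 1)) (n : ℕ) => Φ.nthRecordOf i n z
  ε / (N + 1 : ℝ) * ∑ i : Fin (N + 1), ∑ n ∈ Finset.range (cnt z i), h i n (Φ.coarsePastOf q i n z, Φ.nthPartnerOf i n z) * g ((c z i n).impactVec, (c z i n).preVel.1, (c z i n).preVel.2)

/-- The weights in `KickIsotropyInfo`'s class that are a function `s` of the two pre-collisional velocities only,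
read off the coarse past (velocity of `i` in the first snapshot, of the partner `l` in the second). [folklore] -/
def velWeight (N : ℕ) (s : V3 × V3 → ℝ) : PastWeight N :=
  fun i _ p => s ((p.1.1 i).2, (p.1.2 p.2).2)

/-- `velWeight` is a measurable weight family. [folklore] -/
theorem measurable_velWeight {N : ℕ} {s : V3 × V3 → ℝ} (hs : Measurable s) (i : Fin (N + 1)) (n : ℕ) :
    Measurable (velWeight N s i n) := by
  unfold velWeight
  refine hs.comp (Measurable.prodMk ?_ ?_)
  · exact measurable_snd.comp ((measurable_pi_apply i).comp (measurable_fst.comp measurable_fst))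
  · have : Measurable fun p : ((Fin (N + 1) → (Fin 3 → ℤ) × V3) × (Fin (N + 1) → (Fin 3 → ℤ) × V3)) ×
        Fin (N + 1) => (p.1.2 p.2).2 :=
      measurable_from_prod_countable_left fun l =>
        measurable_snd.comp ((measurable_pi_apply l).comp measurable_snd)
    exact this

/-- `|velWeight| ≤ 1` when `|s| ≤ 1`. [folklore] -/
theorem abs_velWeight_le {N : ℕ} {s : V3 × V3 → ℝ} (hs : ∀ p, |s p| ≤ 1) (i : Fin (N + 1)) (n : ℕ)
    (p : ((Fin (N + 1) → (Fin 3 → ℤ) × V3) × (Fin (N + 1) → (Fin 3 → ℤ) × V3)) × Fin (N + 1)) :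
    |velWeight N s i n p| ≤ 1 :=
  hs _

/-! ## The kick-matched comparison gas `Z*` -/

/-- The die thrown at ONE collision of `Z*`: a sequence of points of `ℝ²` (i.i.d. uniform on the unit disc under
`kmDice`), consumed by rejection sampling of an ADMISSIBLE normal. [folklore] -/
abbrev Die : Type := ℕ → EuclideanSpace ℝ (Fin 2)

/-- The uniform probability law on the closed unit disc of `ℝ²` (Lebesgue measure restricted and normalised); its
push-forward under Lambert's lift `Lambert.lift a` is the flux (Knudsen cosine) law `⟪ω, a⟫₊ dσ(ω)` of the hemisphere
about `a`, normalised (Comets–Popov–Schütz–Vachkovskaia 2008 §2.2, the cosine reflection law). [folklore] -/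
def discLaw : Measure (EuclideanSpace ℝ (Fin 2)) :=
  (volume (Metric.closedBall (0 : EuclideanSpace ℝ (Fin 2)) 1))⁻¹ •
    volume.restrict (Metric.closedBall (0 : EuclideanSpace ℝ (Fin 2)) 1)

/-- `discLaw` is a probability measure (the closed unit disc has positive finite volume). [folklore] -/
instance isProbabilityMeasure_discLaw : IsProbabilityMeasure discLaw := by
  have h0 : volume (Metric.closedBall (0 : EuclideanSpace ℝ (Fin 2)) 1) ≠ 0 :=
    (Metric.measure_closedBall_pos volume _ one_pos).ne'
  have h1 : volume (Metric.closedBall (0 : EuclideanSpace ℝ (Fin 2)) 1) ≠ ∞ := measure_closedBall_lt_top.ne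
  refine ⟨?_⟩
  simp only [discLaw, Measure.smul_apply, Measure.restrict_apply_univ, smul_eq_mul]
  exact ENNReal.inv_mul_cancel h0 h1

/-- The law of ALL dice of `Z*`: one independent `Die` per collision, each an i.i.d. uniform-disc sequence
(`KernelGas.dice` twice: `(discLaw^{⊗ℕ})^{⊗ℕ}`). [folklore] -/
def kmDice : Measure (ℕ → Die) :=
  KernelGas.dice (KernelGas.dice discLaw)

/-- `kmDice` is a probability measure. [folklore] -/
instance isProbabilityMeasure_kmDice : IsProbabilityMeasure kmDice := by
  unfold kmDice; infer_instance

/-- **Resolve a contact of the ordered pair `(i, j)` of `y` with the (unit) normal `ω`**: RE-PLACE the partner `j` at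
contact along `ω` from the centre of `i` (`x_j := x_i − ε ω`, an `O(ε)` move — the price of keeping the hard-core
Gibbs law invariant), then reflect the pair SPECULARLY about `ω` (`collidePair`, whose separation vector is now `ε ω`).
For `ω` = the true impact vector this is the true elastic collision (`x_j` is where it was). [folklore] -/
def kickAt (σ : ℝ) (N : ℕ) (i j : Fin (N + 1)) (ω : V3) (y : Cfg N) : Cfg N :=
  collidePair geo i j (Function.update y j (geo.translate (y i).1 (-(hsDiameter σ N • ω)), (y j).2))

/-- A normal `ω` is ADMISSIBLE for the pair `(i, j)` of the pre-collisional configuration `y`: unit, on the incoming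
hemisphere (`(w − v)·ω > 0`, `v = v_i`, `w = v_j` — the support of the flux law `hardSphereKernel (w, v) ω`), and the
re-placed configuration has no overlap (`hardSphereDomain`). The RESTRICTED reference flux law lives on this set.
[folklore] -/
def IsAdmissible (σ : ℝ) (N : ℕ) (i j : Fin (N + 1)) (ω : V3) (y : Cfg N) : Prop :=
  ‖ω‖ = 1 ∧ 0 < ⟪(y j).2 - (y i).2, ω⟫ ∧ kickAt σ N i j ω y ∈ hardSphereDomain geo (N + 1) (hsDiameter σ N)

open Classical in
/-- **The resampled normal** of `Z*` at a contact of `(i, j)` in `y`, driven by the die `d`: REJECTION SAMPLING of the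
flux law restricted to admissible normals — the candidates `Lambert.lift a (d n)` (`a = (w − v)/|w − v|`; a uniform disc
point lifted to the hemisphere about `a` is flux-distributed) are scanned and the first admissible one is taken. Junk
(the true normal `ε⁻¹(x_i − x_j)`) if no candidate is admissible — a `kmDice`-null event whenever the admissible set has
positive flux measure. [folklore] -/
def kmNormal (σ : ℝ) (N : ℕ) (i j : Fin (N + 1)) (y : Cfg N) (d : Die) : V3 :=
  let a : V3 := ‖(y j).2 - (y i).2‖⁻¹ • ((y j).2 - (y i).2)
  if h : ∃ n : ℕ, ‖d n‖ ≤ 1 ∧ IsAdmissible σ N i j (Lambert.lift a (d n)) y then Lambert.lift a (d (Nat.find h))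
  else (hsDiameter σ N)⁻¹ • geo.sepVec (y i).1 (y j).1

/-- The pair rule of `Z*` (a `Driven` rule with noise space `Die`): resolve the contact with the resampled normal.
[folklore] -/
def kmRule (σ : ℝ) (N : ℕ) : Fin (N + 1) → Fin (N + 1) → Cfg N → Die → Cfg N :=
  fun i j y d => kickAt σ N i j (kmNormal σ N i j y d) y

/-- **The kick-matched gas `Z*`**: free flight to the next geometric contact (`Alexander.freeExitTime`, same partner
SELECTION as the deterministic gas), then `kmRule` with a fresh die — the library's `Driven.flow` (right-continuous,
forward in time), as a deterministic function of the initial datum `z` and of the dice `u`. [folklore] -/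
def kmFlow (σ : ℝ) (N : ℕ) (u : ℕ → Die) (z : Cfg N) (t : ℝ) : Cfg N :=
  Driven.flow geo (hsDiameter σ N) (kmRule σ N) u z t

/-- The defect of the COMPARISON gas: `defect` on the `Z*` path from `q.1` with dice `q.2`. [folklore] -/
abbrev starDefect (σ : ℝ) (N : ℕ) (τ : ℝ) (χ : ℝ × T3 → ℝ) (Ψ : V3 × V3 × V3 → ℝ) (r : ℝ)
    (q : Cfg N × (ℕ → Die)) : ℝ :=
  defect σ N τ χ Ψ r fun s => kmFlow σ N q.2 q.1 s

/-! ## The chronological one-kick swap -/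

/-- The `k`-th collision time in `(0, ∞)` of the orbit of `z` (`k = 0` the first; junk beyond the last). [folklore] -/
def collTime (σ : ℝ) (N : ℕ) (Φ : Flow σ N) (z : Cfg N) (k : ℕ) : ℝ :=
  nthCollisionTime geo (hsDiameter σ N) (fun t => Φ.flow t z) 0 k

/-- Number of collisions of the orbit of `z` in `(0, τ]`. [folklore] -/
def numColl (σ : ℝ) (N : ℕ) (Φ : Flow σ N) (τ : ℝ) (z : Cfg N) : ℕ :=
  Set.ncard (collisionTimes geo (hsDiameter σ N) (fun t => Φ.flow t z) ∩ Set.Ioc 0 τ)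

/-- The post-collisional configuration at the `k`-th collision (the orbit is right-continuous). [folklore] -/
def postAt (σ : ℝ) (N : ℕ) (Φ : Flow σ N) (z : Cfg N) (k : ℕ) : Cfg N :=
  Φ.flow (collTime σ N Φ z k) z

open Classical in
/-- The colliding pair `(i, j)`, `i < j`, of the `k`-th collision (junk `(0, 0)` if none is in contact). [folklore] -/
def pairAt (σ : ℝ) (N : ℕ) (Φ : Flow σ N) (z : Cfg N) (k : ℕ) : Fin (N + 1) × Fin (N + 1) :=
  let S := (contactPairs geo (hsDiameter σ N) (postAt σ N Φ z k)).filter fun p => p.1 < p.2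
  if h : S.Nonempty then h.choose else (0, 0)

/-- The PRE-collisional configuration of the `k`-th collision, recovered from the post-collisional one by the
involution `collidePair` (= the left limit of the orbit, `IsHardSphereTrajectory.eq_collidePair_leftLim`). [folklore] -/
def preAt (σ : ℝ) (N : ℕ) (Φ : Flow σ N) (z : Cfg N) (k : ℕ) : Cfg N :=
  collidePair geo (pairAt σ N Φ z k).1 (pairAt σ N Φ z k).2 (postAt σ N Φ z k)

/-- The TRUE impact vector `ω_k = ε⁻¹ (x_i − x_j)` of the `k`-th collision. [folklore] -/
def trueKick (σ : ℝ) (N : ℕ) (Φ : Flow σ N) (z : Cfg N) (k : ℕ) : V3 :=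
  (hsDiameter σ N)⁻¹ •
    geo.sepVec ((postAt σ N Φ z k) (pairAt σ N Φ z k).1).1 ((postAt σ N Φ z k) (pairAt σ N Φ z k).2).1

/-- **The continuation path of the `k`-th swap**: the TRUE orbit strictly before the `k`-th collision time, then the
`Z*` path (dice `u`) restarted from the pre-collisional configuration resolved with the kick `ω` (true past, random
future). [folklore] -/
def contPath (σ : ℝ) (N : ℕ) (Φ : Flow σ N) (z : Cfg N) (k : ℕ) (ω : V3) (u : ℕ → Die) (s : ℝ) : Cfg N :=
  if s < collTime σ N Φ z k then Φ.flow s z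
  else kmFlow σ N u (kickAt σ N (pairAt σ N Φ z k).1 (pairAt σ N Φ z k).2 ω (preAt σ N Φ z k))
    (s - collTime σ N Φ z k)

/-- The smoothed indicator `φ_η(x) = min 1 ((|x| − η)₊ / η)`: for `η > 0` it is `η⁻¹`-Lipschitz, `= 1` on `|x| ≥ 2η`,
`= 0` on `|x| ≤ η`, with values in `[0, 1]` — the bounded Lipschitz statistic through which "in probability" is
compared (junk for `η ≤ 0`: `η = 0` gives `0`, `η < 0` gives nonpositive values). [folklore] -/
def phiEta (η x : ℝ) : ℝ :=
  min 1 (max (|x| - η) 0 / η)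

/-- **The `Z*`-value of resolving the `k`-th TRUE collision with the kick `ω`**: the dice-expectation of
`φ_η ∘ defect` of the continuation path (a "random-future value function"; Bochner integral, junk `0` if not
integrable). [folklore] -/
def swapValue (σ : ℝ) (N : ℕ) (Φ : Flow σ N) (τ : ℝ) (χ : ℝ × T3 → ℝ) (Ψ : V3 × V3 × V3 → ℝ) (r η : ℝ)
    (z : Cfg N) (k : ℕ) (ω : V3) : ℝ :=
  ∫ u, phiEta η (defect σ N τ χ Ψ r (contPath σ N Φ z k ω u)) ∂kmDice

/-! ## The swap identity -/

/-- The TRUE path of an abstract chronological dynamics `T k` (resolve the `k`-th contact the true way). [folklore] -/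
def truePath {S : Type*} (T : ℕ → S → S) (z : S) : ℕ → S
  | 0 => z
  | k + 1 => T k (truePath T z k)

/-- **Stein–Lindeberg (generator-comparison) identity** (a telescoping sum, `Finset.sum_range_sub`; no dynamical
content: `M = 0` gives `0 = 0`). For the random-future value functions `U k` of a comparison chain
(`U k = P k (U (k+1))`, `P k` the comparison one-step operator, `U M = φ`), the statistic of the true path minus its
comparison value at time `0` is the CHRONOLOGICAL sum of ONE-STEP SWAP terms `U_{k+1}(T_k z_k) − (P_k U_{k+1})(z_k)` —
true past, random future (the swapping scheme of Lindeberg's method, Chatterjee 2006). [folklore] -/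
theorem stein_lindeberg_identity {S : Type*} (T : ℕ → S → S) (P : ℕ → (S → ℝ) → (S → ℝ)) (U : ℕ → S → ℝ)
    (φ : S → ℝ) (M : ℕ) (hU : ∀ k < M, U k = P k (U (k + 1))) (hM : U M = φ) (z : S) :
    φ (truePath T z M) - U 0 z =
      ∑ k ∈ Finset.range M, (U (k + 1) (T k (truePath T z k)) - P k (U (k + 1)) (truePath T z k)) :=
  calc φ (truePath T z M) - U 0 z = U M (truePath T z M) - U 0 (truePath T z 0) := by rw [hM]; rfl
    _ = ∑ k ∈ Finset.range M, (U (k + 1) (truePath T z (k + 1)) - U k (truePath T z k)) :=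
      (Finset.sum_range_sub (fun k => U k (truePath T z k)) M).symm
    _ = ∑ k ∈ Finset.range M, (U (k + 1) (T k (truePath T z k)) - P k (U (k + 1)) (truePath T z k)) :=
      Finset.sum_congr rfl fun k hk => by rw [← hU k (Finset.mem_range.1 hk)]; rfl

/-- Every kick at one contact leaves the same outgoing pair momentum (`reflectVel_fst_add_reflectVel_snd`): a kick
swap carries no conserved content. [folklore] -/
theorem outgoing_momentum_eq (ω ω' : V3) (p : V3 × V3) :
    (reflectVel ω p).1 + (reflectVel ω p).2 = (reflectVel ω' p).1 + (reflectVel ω' p).2 := by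
  rw [reflectVel_fst_add_reflectVel_snd, reflectVel_fst_add_reflectVel_snd]

/-- … and the same outgoing pair kinetic energy (`norm_sq_reflectVel_fst_add_norm_sq_reflectVel_snd`). [folklore] -/
theorem outgoing_energy_eq (ω ω' : V3) (p : V3 × V3) :
    ‖(reflectVel ω p).1‖ ^ 2 + ‖(reflectVel ω p).2‖ ^ 2 = ‖(reflectVel ω' p).1‖ ^ 2 + ‖(reflectVel ω' p).2‖ ^ 2 := by
  rw [norm_sq_reflectVel_fst_add_norm_sq_reflectVel_snd, norm_sq_reflectVel_fst_add_norm_sq_reflectVel_snd]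

/-! ## The restricted reference, the one-kick influence and the swap sum -/

/-- The (unnormalised) FLUX LAW of the impact vector of a pair with velocities `v = v_i`, `w = v_j`: density
`((w − v)·ω)₊ = hardSphereKernel (w, v) ω` on the unit sphere — the reference law of `IsFluxMeanZero` and the proposal
law of `kmNormal`'s rejection sampler. [folklore] -/
def fluxLaw (v w : V3) : Measure (Metric.sphere (0 : V3) 1) :=
  sphereMeasure.withDensity fun ω => ENNReal.ofReal (hardSphereKernel (w, v) ω)

/-- **The RESTRICTED reference mean** at the `k`-th collision: the average of `F` over ADMISSIBLE normals under the
flux law of the colliding pair, normalised (junk `0·…` if the admissible set is flux-null) — the one-step operator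
`P_k` of `Z*`. [folklore] -/
def restrictedMean (σ : ℝ) (N : ℕ) (Φ : Flow σ N) (z : Cfg N) (k : ℕ) (F : V3 → ℝ) : ℝ :=
  let y := preAt σ N Φ z k
  let p := pairAt σ N Φ z k
  let A : Set (Metric.sphere (0 : V3) 1) := {ω | IsAdmissible σ N p.1 p.2 (ω : V3) y}
  let μ := fluxLaw (y p.1).2 (y p.2).2
  (μ A).toReal⁻¹ * ∫ ω in A, F (ω : V3) ∂μ

/-- **The one-kick influence** at the `k`-th collision of the orbit of `z`: the oscillation of the `Z*`-value
`swapValue` over pairs of ADMISSIBLE kicks (`Real.iSup`: `0` if none is admissible or if unbounded). [folklore] -/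
def influence (σ : ℝ) (N : ℕ) (Φ : Flow σ N) (τ : ℝ) (χ : ℝ × T3 → ℝ) (Ψ : V3 × V3 × V3 → ℝ) (r η : ℝ)
    (z : Cfg N) (k : ℕ) : ℝ :=
  ⨆ p : {p : V3 × V3 //
      IsAdmissible σ N (pairAt σ N Φ z k).1 (pairAt σ N Φ z k).2 p.1 (preAt σ N Φ z k) ∧
        IsAdmissible σ N (pairAt σ N Φ z k).1 (pairAt σ N Φ z k).2 p.2 (preAt σ N Φ z k)},
    |swapValue σ N Φ τ χ Ψ r η z k p.1.1 - swapValue σ N Φ τ χ Ψ r η z k p.1.2|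

open Classical in
/-- **The `k`-th ONE-KICK SWAP INTEGRAND with the restricted reference**:
`D_k(ω) = 1_adm(ω) · (swapValue_k(ω) − restricted admissible-flux mean of swapValue_k)` — zero off the admissible
set, hence of unrestricted flux mean zero whenever the restricted mean is a genuine mean. [folklore] -/
def swapIntegrand (σ : ℝ) (N : ℕ) (Φ : Flow σ N) (τ : ℝ) (χ : ℝ × T3 → ℝ) (Ψ : V3 × V3 × V3 → ℝ) (r η : ℝ)
    (z : Cfg N) (k : ℕ) (ω : V3) : ℝ :=
  if IsAdmissible σ N (pairAt σ N Φ z k).1 (pairAt σ N Φ z k).2 ω (preAt σ N Φ z k) then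
    swapValue σ N Φ τ χ Ψ r η z k ω - restrictedMean σ N Φ z k (swapValue σ N Φ τ χ Ψ r η z k)
  else 0

/-- **The chronological swap sum** of the orbit of `z`: `Σ_{k < numColl} D_k(ω_k)` at the TRUE kicks. [folklore] -/
def swapSum (σ : ℝ) (N : ℕ) (Φ : Flow σ N) (τ : ℝ) (χ : ℝ × T3 → ℝ) (Ψ : V3 × V3 × V3 → ℝ) (r η : ℝ)
    (z : Cfg N) : ℝ :=
  ∑ k ∈ Finset.range (numColl σ N Φ τ z), swapIntegrand σ N Φ τ χ Ψ r η z k (trueKick σ N Φ z k)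

/-! ## API -/

/-- Off the admissible set the swap integrand vanishes. [folklore] -/
theorem swapIntegrand_of_not_admissible {σ : ℝ} {N : ℕ} {Φ : Flow σ N} {τ : ℝ} {χ : ℝ × T3 → ℝ}
    {Ψ : V3 × V3 × V3 → ℝ} {r η : ℝ} {z : Cfg N} {k : ℕ} {ω : V3}
    (h : ¬ IsAdmissible σ N (pairAt σ N Φ z k).1 (pairAt σ N Φ z k).2 ω (preAt σ N Φ z k)) :
    swapIntegrand σ N Φ τ χ Ψ r η z k ω = 0 := by
  classical
  simp [swapIntegrand, h]

/-- `φ_η ≤ 1`. [folklore] -/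
theorem phiEta_le_one (η x : ℝ) : phiEta η x ≤ 1 :=
  min_le_left _ _

/-- `0 ≤ φ_η` for `0 ≤ η`. [folklore] -/
theorem phiEta_nonneg {η : ℝ} (hη : 0 ≤ η) (x : ℝ) : 0 ≤ phiEta η x :=
  le_min zero_le_one (div_nonneg (le_max_right _ _) hη)

/-- `|φ_η| ≤ 1` for `0 ≤ η`. [folklore] -/
theorem abs_phiEta_le_one {η : ℝ} (hη : 0 ≤ η) (x : ℝ) : |phiEta η x| ≤ 1 :=
  abs_le.2 ⟨by linarith [phiEta_nonneg hη x], phiEta_le_one η x⟩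

/-- `|swapValue| ≤ 1` for `0 ≤ η`: the integrand `φ_η ∘ defect` lies in `[0, 1]` and `kmDice` is a probability law
(no integrability needed — the junk value `0` also obeys the bound). [folklore] -/
theorem abs_swapValue_le_one {σ : ℝ} {N : ℕ} (Φ : Flow σ N) (τ : ℝ) (χ : ℝ × T3 → ℝ) (Ψ : V3 × V3 × V3 → ℝ)
    (r : ℝ) {η : ℝ} (hη : 0 ≤ η) (z : Cfg N) (k : ℕ) (ω : V3) :
    |swapValue σ N Φ τ χ Ψ r η z k ω| ≤ 1 := by
  have h := norm_integral_le_of_norm_le_const (μ := kmDice) (C := 1)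
    (f := fun u => phiEta η (defect σ N τ χ Ψ r (contPath σ N Φ z k ω u)))
    (Filter.Eventually.of_forall fun u => by simpa only [Real.norm_eq_abs] using abs_phiEta_le_one hη _)
  simpa only [swapValue, Real.norm_eq_abs, probReal_univ, mul_one] using h

end KickMatchedHardSphereGas

/-- **The kick-matched hard-sphere gas `Z*`** as the time-`t` map on (initial datum, dice):
`KickMatchedHardSphereGas σ N t (z, u) = kmFlow σ N u z t` — the map whose measurability / Gibbs-stationarity under
`localGibbsLaw ⊗ kmDice` the line's construction statement asserts. [folklore] -/
def KickMatchedHardSphereGas (σ : ℝ) (N : ℕ) (t : ℝ)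
    (q : KickMatchedHardSphereGas.Cfg N × (ℕ → KickMatchedHardSphereGas.Die)) : KickMatchedHardSphereGas.Cfg N :=
  KickMatchedHardSphereGas.kmFlow σ N q.2 q.1 t

/-- Unfolding of `KickMatchedHardSphereGas` (definitional). [folklore] -/
theorem kickMatchedHardSphereGas_apply (σ : ℝ) (N : ℕ) (t : ℝ) (z : KickMatchedHardSphereGas.Cfg N)
    (u : ℕ → KickMatchedHardSphereGas.Die) :
    KickMatchedHardSphereGas σ N t (z, u) = KickMatchedHardSphereGas.kmFlow σ N u z t := rfl

end Literature.MathematicalPhysics.KineticTheory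

end
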